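import Summits.QuantumFields.BalabanUV.Beta.GAN24.Push4

/-!
# `BalabanUV.Beta.GAN24.Push4Bounds` — binder row G-an2-4 / (CONV-C), W-slot road «W3» (SKELETON-W3 v0.2 §7.3/7.4 (F1)/(F3)): the four-leg push
# through leg families at rate `m`: two-rate («rate-KEPT») superposition bricks and the table legs of `push₄` at ONE FIXED RATE
# (`biLoc_vertexW_keep`, `biLoc_vertex2W_keep`: `LocStencil₂ X C δ`, legs at rate `m > 3δ` ⟹ rate `δ` KEPT, constants explicit) — part 1 of 2

NOT IN PRINT; OUR PROOF ATTEMPT (G-an2-4 formalisation swarm, leaf prover `b2b-balaban-gan24-formalise-leaf-17`, gen 14; companion of `GAN24/Push4`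
(p210922); names PROVISIONAL — the row owner gan24-p1 may rename / re-cut).  HONEST FRAMING (cell contract, verbatim): «discharging `BetaPertH` makes
Bałaban's UV stability UNCONDITIONAL — a real constructive-QFT result; it is NOT the continuum limit and NOT the Clay problem.»  HONEST DEPENDENCY
(verbatim): «continuum YM on T⁴ ⇐ BetaPertH ∧ nine spine estimates (0/9 proved); BetaPertH ⇐ (D1) ∧ (D4) ∧ CAP+tail; G-an2-4 gates asym, D1 and
NE2/3/4.»

WHY (RULINGS-12 (R12-2): «rows at ONE FIXED output rate, constants OUTSIDE ∀ j, never m∕16 per level»; leaf-02-g14 l.7060 (b): the tree's bricks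
halve the rate at every use and `biLoc_mmRead` throws the dilation away).  The existing localisation bricks (`OneStepResolventKernel.biLoc_wsum`,
`ExpKernelCalculus.biLoc_comp_decays`, `BalabanCompositeJets.biLoc_wsum_far/_two`, an2's `vertexFamily₂_vertex2OfK`) take the weights and the
transported kernels AT THE SAME RATE and return a SMALLER rate.  Here the STRUCTURAL data (leg families, at rate `m`) and the TRANSPORTED table (at
rate `δ`) carry TWO rates, and for `m > 2δ` (resp. `3δ`) the output keeps the table's rate `δ` EXACTLY, with constants `Zl(m − 2δ)` (resp. `Zl(m−δ)`,
`Zl(m − 3δ)`); the push to the `N`-coarse lattice then DILATES the rate to `N·δ` for free (`l1 (N•z) = N·l1 z`).  No new idea — the triangle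
inequality budgeted differently; [folklore] throughout.

CONTENT.
* §1 `LegDecay r N C m := ∀ μ y κ u, |r μ y κ u| ≤ C·e^{−m·l1(u − N•y)}` (a leg family localised at the dilated coarse point; `colH K N` and `rowM K N`
  of a decaying `K` are instances: `legDecay_colH`, `legDecay_rowM`); `LegDecay.nonneg/abs_le/summable`.
* §2 RATE-KEPT SUPERPOSITION BRICKS (generic `D`, `F`): `biLoc_wsum_keep` (weights at rate `m` from `p`, kernels self-localised at rate `δ`, `2δ < m` ⟹
  bi-localised at `p` AT RATE `δ`), `biLoc_wsum_far_keep` (kernels at a fixed centre `p` with constants decaying at rate `δ` from `p` in the summation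
  variable, weights at rate `m` from `q`, `δ < m` ⟹ constant decaying `e^{−δ|p−q|}`, rate untouched), `biLoc_wsum_twoCentre_keep` (weights from `p`,
  kernels self-localised with constants decaying from `q`, `3δ < m` ⟹ at `p` with far factor `e^{−δ|p−q|}`, rate `δ`).
* §3 THE VERTICES AT KEPT RATE: `biLoc_vertexW_keep` (`LocStencil S Cs δ`, legs at rate `m > 2δ` ⟹ `BiLoc (vertexW r S μ y) (N•y) (N•y) ((d+1)·C_r·Cs·Zl(m−2δ)) δ`),
  `biLoc_vertexW_slice_keep` (the inner slice of a `LocStencil₂` table: centred at the first bond with far factor to `N•y′`, rate `δ`, `m > δ`),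
  `locStencil_slice_keep` (packaged), **`biLoc_vertex2W_keep`** (`LocStencil₂ X C δ`, `m > 3δ` ⟹ `BiLoc (vertex2W r X μ y ν y′) (N•y) (N•y)
  ((d+1)²·C_r²·C·Zl(m−δ)·Zl(m−3δ)·e^{−δ·l1(N•y − N•y′)}) δ` — an2's `vertexFamily₂_vertex2OfK` shape WITHOUT the rate loss `m ↦ m/8`).
* (§4 = the companion module `GAN24/Push4LocStencil`: the kernel legs at kept rate and **`locStencil₂_push₄`**:
  `LegDecay l N C_l m → LegDecay r N C_r m → LocStencil₂ X C δ → 0 ≤ δ → 3δ < m → LocStencil₂ (push₄ l r X) (cPush d C_l C_r m δ · C) (N·δ)`.)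
[folklore]; 0 cited facts, 0 `Prop` mirrors (`LegDecay` is a PREDICATE with parameters), 0 sorry.  Asserts NO shape of Bałaban's tables; «T2Shape» /
«T2SupRate» LOCATED / OPEN, NOT IN PRINT; discharges NOTHING of (hW, hWall); 0 wall binders instantiated; NOT «W-slot closed», NEVER «G-an2-4 closed»;
NOT BetaPertH, NOT continuum, NOT Clay.
-/

noncomputable section

open Finset
open scoped BigOperators
open Literature.MathematicalPhysics.QuantumFieldTheory
open Literature.MathematicalPhysics.QuantumFieldTheory.Balaban1983to89
open Literature.MathematicalPhysics.QuantumFieldTheory.Balaban1983to89.Beta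
open B12Sec2to5 (l1 l1_nonneg)
open ExpKernelCalculus (MKer Decays BiLoc comp Zl Zl_nonneg l1_sub_triangle l1_sub_symm l1_natSmul summable_exp_shift summable_exp_shift'
  tsum_exp_shift tsum_exp_shift')
open OneStepResolventKernel (Fib wsum LocStencil biLoc_finset_sum biLoc_mono)
open OneStepKernelFamily (colH)
open BalabanCompositeJets (LocStencil₂)
open Summit.QuantumFields.BalabanUV.Beta.GAN24.Push4 (rowM rowM_apply colH_apply' vertexW vertexW_apply vertex2W Lk Rk ffRead push₄
  Lk_inl_inl Lk_inl_inr Lk_inr Rk_inl_inl Rk_inr_left Rk_inr_right ffRead_inl_inl ffRead_inr_left ffRead_inr_right push₄_def)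

namespace Summit.QuantumFields.BalabanUV.Beta.GAN24.Push4Bounds

variable {d : ℕ}

/-! ## §1 Leg families localised at the dilated coarse point -/

/-- [folklore] **A LEG FAMILY LOCALISED AT RATE `m`**: `|r μ y κ u| ≤ C·e^{−m·|u − N•y|₁}` — the fine index `u` sits near the `N`-dilate of the coarse
index `y`.  (A predicate with parameters; `colH K N` / `rowM K N` of a decaying `K` are instances.) -/
def LegDecay (r : Fin (d + 1) → (Fin (d + 1) → ℤ) → Fin (d + 1) → (Fin (d + 1) → ℤ) → ℝ) (N : ℕ) (C m : ℝ) : Prop :=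
  ∀ μ y κ u, |r μ y κ u| ≤ C * Real.exp (-m * l1 (u - (N : ℤ) • y))

variable {r l : Fin (d + 1) → (Fin (d + 1) → ℤ) → Fin (d + 1) → (Fin (d + 1) → ℤ) → ℝ} {N : ℕ} {C Cr Cl m δ : ℝ}

/-- [folklore] The constant of a `LegDecay` bound is nonnegative. -/
theorem LegDecay.nonneg (h : LegDecay r N Cr m) : 0 ≤ Cr := by
  have h0 := h 0 0 0 ((N : ℤ) • (0 : Fin (d + 1) → ℤ))
  rw [sub_self, show l1 (0 : Fin (d + 1) → ℤ) = 0 by simp [l1], mul_zero, Real.exp_zero, mul_one] at h0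
  exact (abs_nonneg _).trans h0

/-- [folklore] A leg family localised at a nonnegative rate is uniformly bounded by its constant. -/
theorem LegDecay.abs_le (h : LegDecay r N Cr m) (hm : 0 ≤ m) (μ : Fin (d + 1)) (y : Fin (d + 1) → ℤ) (κ : Fin (d + 1))
    (u : Fin (d + 1) → ℤ) : |r μ y κ u| ≤ Cr := by
  refine (h μ y κ u).trans ?_
  have : Real.exp (-m * l1 (u - (N : ℤ) • y)) ≤ 1 := by
    rw [Real.exp_le_one_iff]; nlinarith [l1_nonneg (u - (N : ℤ) • y)]
  nlinarith [h.nonneg]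

/-- [folklore] A leg family localised at a positive rate is summable in its fine index. -/
theorem LegDecay.summable (h : LegDecay r N Cr m) (hm : 0 < m) (μ : Fin (d + 1)) (y : Fin (d + 1) → ℤ) (κ : Fin (d + 1)) :
    Summable fun u => r μ y κ u := by
  refine Summable.of_norm_bounded ((summable_exp_shift' hm ((N : ℤ) • y)).mul_left Cr) (fun u => ?_)
  rw [Real.norm_eq_abs]
  exact h μ y κ u

/-- [folklore] The `ℋ`-column family of a decaying kernel is a localised leg family (an4's `abs_colH_le`). -/
theorem legDecay_colH {K : MKer (d + 1) (Fib d)} (hK : Decays K C m) : LegDecay (colH K N) N C m :=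
  fun _ _ _ _ => hK _ _ _ _

/-- [folklore] The mf-row family of a decaying kernel is a localised leg family. -/
theorem legDecay_rowM {K : MKer (d + 1) (Fib d)} (hK : Decays K C m) : LegDecay (rowM K N) N C m := by
  intro α x' κ x
  rw [rowM_apply, l1_sub_symm]
  exact hK _ _ _ _

/-! ## §2 Rate-kept superposition bricks (generic dimension and fibre) -/

section Bricks

variable {D : ℕ} {F : Type*}

/-- [folklore] **WEIGHTED SUM AT KEPT RATE**: weights decaying at rate `m` from `p`, kernels self-localised at rate `δ` with `2δ < m` ⟹ the superposition
is bi-localised at `p` AT RATE `δ` (constant `C·Cₖ·Zl(m − 2δ)`; compare `OneStepResolventKernel.biLoc_wsum`, same rates in, `δ/2` out). -/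
theorem biLoc_wsum_keep {w : (Fin D → ℤ) → ℝ} {K : (Fin D → ℤ) → MKer D F} {Cw Ck m δ : ℝ} {p : Fin D → ℤ}
    (hw : ∀ u, |w u| ≤ Cw * Real.exp (-m * l1 (u - p))) (hK : ∀ u, BiLoc (K u) u u Ck δ) (hδ : 0 ≤ δ) (hm : 2 * δ < m) (hCw : 0 ≤ Cw) :
    BiLoc (wsum w K) p p (Cw * Ck * Zl D (m - 2 * δ)) δ := by
  intro x z a b
  unfold wsum
  have hCk : 0 ≤ Ck := (hK p).nonneg a
  have hs := (summable_exp_shift' (show 0 < m - 2 * δ by linarith) p).mul_left (Cw * Ck * Real.exp (-δ * (l1 (x - p) + l1 (z - p))))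
  have hb := tsum_of_norm_bounded hs.hasSum (fun u => by
    rw [Real.norm_eq_abs, abs_mul]
    have h1 := hw u
    have h2 := hK u x z a b
    have hexp : Real.exp (-m * l1 (u - p)) * Real.exp (-δ * (l1 (x - u) + l1 (z - u)))
        ≤ Real.exp (-δ * (l1 (x - p) + l1 (z - p))) * Real.exp (-(m - 2 * δ) * l1 (u - p)) := by
      rw [← Real.exp_add, ← Real.exp_add, Real.exp_le_exp]
      have tx := l1_sub_triangle x u p
      have tz := l1_sub_triangle z u p
      nlinarith [mul_nonneg hδ (show 0 ≤ l1 (x - u) + l1 (u - p) - l1 (x - p) by linarith),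
        mul_nonneg hδ (show 0 ≤ l1 (z - u) + l1 (u - p) - l1 (z - p) by linarith)]
    calc |w u| * |K u x z a b| ≤ (Cw * Real.exp (-m * l1 (u - p))) * (Ck * Real.exp (-δ * (l1 (x - u) + l1 (z - u)))) :=
          mul_le_mul h1 h2 (abs_nonneg _) (by positivity)
      _ = Cw * Ck * (Real.exp (-m * l1 (u - p)) * Real.exp (-δ * (l1 (x - u) + l1 (z - u)))) := by ring
      _ ≤ Cw * Ck * (Real.exp (-δ * (l1 (x - p) + l1 (z - p))) * Real.exp (-(m - 2 * δ) * l1 (u - p))) :=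
          mul_le_mul_of_nonneg_left hexp (mul_nonneg hCw hCk)
      _ = _ := by ring)
  rw [Real.norm_eq_abs] at hb
  refine hb.trans (le_of_eq ?_)
  rw [tsum_mul_left, tsum_exp_shift']
  ring

/-- [folklore] **WEIGHTED SUM, FAR CENTRE, KEPT RATE**: weights decaying at rate `m` from `q`; kernels all bi-localised at a FIXED `p` (rate `δ′`) with
constants decaying at rate `δ < m` in the distance of the summation variable from `p` ⟹ bi-localised at `p`, rate `δ′` untouched, constant
`Cw·Cₖ·Zl(m − δ)·e^{−δ|p − q|}` (compare `BalabanCompositeJets.biLoc_wsum_far`: same rates, far factor at `m/2`). -/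
theorem biLoc_wsum_far_keep {w : (Fin D → ℤ) → ℝ} {K : (Fin D → ℤ) → MKer D F} {Cw Ck m δ δ' : ℝ} {p q : Fin D → ℤ}
    (hw : ∀ u', |w u'| ≤ Cw * Real.exp (-m * l1 (u' - q))) (hK : ∀ u', BiLoc (K u') p p (Ck * Real.exp (-δ * l1 (u' - p))) δ')
    (hδ : 0 ≤ δ) (hm : δ < m) (hCw : 0 ≤ Cw) (hCk : 0 ≤ Ck) :
    BiLoc (wsum w K) p p (Cw * Ck * Zl D (m - δ) * Real.exp (-δ * l1 (p - q))) δ' := by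
  intro x z a b
  unfold wsum
  have hs := (summable_exp_shift' (show 0 < m - δ by linarith) q).mul_left
    (Cw * Ck * Real.exp (-δ' * (l1 (x - p) + l1 (z - p))) * Real.exp (-δ * l1 (p - q)))
  have hb := tsum_of_norm_bounded hs.hasSum (fun u' => by
    rw [Real.norm_eq_abs, abs_mul]
    have h1 := hw u'
    have h2 := hK u' x z a b
    have hexp : Real.exp (-m * l1 (u' - q)) * Real.exp (-δ * l1 (u' - p))
        ≤ Real.exp (-δ * l1 (p - q)) * Real.exp (-(m - δ) * l1 (u' - q)) := by
      rw [← Real.exp_add, ← Real.exp_add, Real.exp_le_exp]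
      have t := l1_sub_triangle p u' q
      rw [l1_sub_symm p u'] at t
      nlinarith [mul_nonneg hδ (show 0 ≤ l1 (u' - p) + l1 (u' - q) - l1 (p - q) by linarith)]
    calc |w u'| * |K u' x z a b|
        ≤ (Cw * Real.exp (-m * l1 (u' - q))) * (Ck * Real.exp (-δ * l1 (u' - p)) * Real.exp (-δ' * (l1 (x - p) + l1 (z - p)))) :=
          mul_le_mul h1 h2 (abs_nonneg _) (by positivity)
      _ = Cw * Ck * Real.exp (-δ' * (l1 (x - p) + l1 (z - p))) * (Real.exp (-m * l1 (u' - q)) * Real.exp (-δ * l1 (u' - p))) := by ring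
      _ ≤ Cw * Ck * Real.exp (-δ' * (l1 (x - p) + l1 (z - p))) * (Real.exp (-δ * l1 (p - q)) * Real.exp (-(m - δ) * l1 (u' - q))) :=
          mul_le_mul_of_nonneg_left hexp (by positivity)
      _ = _ := by ring)
  rw [Real.norm_eq_abs] at hb
  refine hb.trans (le_of_eq ?_)
  rw [tsum_mul_left, tsum_exp_shift']
  ring

/-- [folklore] **WEIGHTED SUM, TWO CENTRES, KEPT RATE**: weights decaying at rate `m` from `p`; kernels self-localised at the summation variable at rate
`δ` with constants decaying at rate `δ` from a second centre `q`; `3δ < m` ⟹ bi-localised at `p` AT RATE `δ` with the far factor `e^{−δ|p − q|}`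
(compare `BalabanCompositeJets.biLoc_wsum_two`: output split at `(p, q)` at rate `m/4`). -/
theorem biLoc_wsum_twoCentre_keep {w : (Fin D → ℤ) → ℝ} {K : (Fin D → ℤ) → MKer D F} {Cw Ck m δ : ℝ} {p q : Fin D → ℤ}
    (hw : ∀ u, |w u| ≤ Cw * Real.exp (-m * l1 (u - p))) (hK : ∀ u, BiLoc (K u) u u (Ck * Real.exp (-δ * l1 (u - q))) δ)
    (hδ : 0 ≤ δ) (hm : 3 * δ < m) (hCw : 0 ≤ Cw) (hCk : 0 ≤ Ck) :
    BiLoc (wsum w K) p p (Cw * Ck * Zl D (m - 3 * δ) * Real.exp (-δ * l1 (p - q))) δ := by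
  intro x z a b
  unfold wsum
  have hs := (summable_exp_shift' (show 0 < m - 3 * δ by linarith) p).mul_left
    (Cw * Ck * Real.exp (-δ * l1 (p - q)) * Real.exp (-δ * (l1 (x - p) + l1 (z - p))))
  have hb := tsum_of_norm_bounded hs.hasSum (fun u => by
    rw [Real.norm_eq_abs, abs_mul]
    have h1 := hw u
    have h2 := hK u x z a b
    have hexp : Real.exp (-m * l1 (u - p)) * (Real.exp (-δ * l1 (u - q)) * Real.exp (-δ * (l1 (x - u) + l1 (z - u))))
        ≤ Real.exp (-δ * l1 (p - q)) * Real.exp (-δ * (l1 (x - p) + l1 (z - p))) * Real.exp (-(m - 3 * δ) * l1 (u - p)) := by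
      rw [← Real.exp_add, ← Real.exp_add, ← Real.exp_add, ← Real.exp_add, Real.exp_le_exp]
      have tx := l1_sub_triangle x u p
      have tz := l1_sub_triangle z u p
      have tq := l1_sub_triangle p u q
      rw [l1_sub_symm p u] at tq
      nlinarith [mul_nonneg hδ (show 0 ≤ l1 (x - u) + l1 (u - p) - l1 (x - p) by linarith),
        mul_nonneg hδ (show 0 ≤ l1 (z - u) + l1 (u - p) - l1 (z - p) by linarith),
        mul_nonneg hδ (show 0 ≤ l1 (u - p) + l1 (u - q) - l1 (p - q) by linarith)]
    calc |w u| * |K u x z a b|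
        ≤ (Cw * Real.exp (-m * l1 (u - p))) * (Ck * Real.exp (-δ * l1 (u - q)) * Real.exp (-δ * (l1 (x - u) + l1 (z - u)))) :=
          mul_le_mul h1 h2 (abs_nonneg _) (by positivity)
      _ = Cw * Ck * (Real.exp (-m * l1 (u - p)) * (Real.exp (-δ * l1 (u - q)) * Real.exp (-δ * (l1 (x - u) + l1 (z - u))))) := by ring
      _ ≤ Cw * Ck * (Real.exp (-δ * l1 (p - q)) * Real.exp (-δ * (l1 (x - p) + l1 (z - p))) * Real.exp (-(m - 3 * δ) * l1 (u - p))) :=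
          mul_le_mul_of_nonneg_left hexp (mul_nonneg hCw hCk)
      _ = _ := by ring)
  rw [Real.norm_eq_abs] at hb
  refine hb.trans (le_of_eq ?_)
  rw [tsum_mul_left, tsum_exp_shift']
  ring

end Bricks

/-! ## §3 The generalised vertices at kept rate -/

/-- [folklore] **THE CHAIN-RULE VERTEX AT KEPT RATE**: a local stencil family at rate `δ` read through a leg family at rate `m > 2δ` is bi-localised at
the dilated coarse point AT RATE `δ`, constant `(d+1)·C_r·Cs·Zl(m − 2δ)`. -/
theorem biLoc_vertexW_keep (hr : LegDecay r N Cr m) {S : Fin (d + 1) → (Fin (d + 1) → ℤ) → MKer (d + 1) (Fib d)} {Cs : ℝ}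
    (hS : LocStencil S Cs δ) (hδ : 0 ≤ δ) (hm : 2 * δ < m) (μ : Fin (d + 1)) (y : Fin (d + 1) → ℤ) :
    BiLoc (vertexW r S μ y) ((N : ℤ) • y) ((N : ℤ) • y) ((d + 1 : ℕ) * (Cr * Cs * Zl (d + 1) (m - 2 * δ))) δ := by
  have hterm : ∀ κ : Fin (d + 1), BiLoc (wsum (r μ y κ) (S κ)) ((N : ℤ) • y) ((N : ℤ) • y) (Cr * Cs * Zl (d + 1) (m - 2 * δ)) δ :=
    fun κ => biLoc_wsum_keep (fun u => hr μ y κ u) (fun u => hS κ u) hδ hm hr.nonneg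
  have hsum := biLoc_finset_sum (Finset.univ : Finset (Fin (d + 1))) (fun κ _ => hterm κ)
  simp only [Finset.sum_const, Finset.card_univ, Fintype.card_fin, nsmul_eq_mul] at hsum
  exact hsum

/-- [folklore] **THE INNER SLICE OF A BI-TABLE AT KEPT RATE**: for `LocStencil₂ X C δ` and a leg family at rate `m > δ`, the vertex of the slice
`X κ u` at the coarse bond `(ν, y′)` is bi-localised at the FIRST bond `u`, rate `δ`, with the far factor `e^{−δ|u − N•y′|}` in its constant. -/
theorem biLoc_vertexW_slice_keep (hr : LegDecay r N Cr m)
    {X : Fin (d + 1) → (Fin (d + 1) → ℤ) → Fin (d + 1) → (Fin (d + 1) → ℤ) → MKer (d + 1) (Fib d)} (hX : LocStencil₂ X C δ)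
    (hδ : 0 ≤ δ) (hm : δ < m) (κ : Fin (d + 1)) (u : Fin (d + 1) → ℤ) (ν : Fin (d + 1)) (y' : Fin (d + 1) → ℤ) :
    BiLoc (vertexW r (X κ u) ν y') u u
      ((d + 1 : ℕ) * (Cr * C * Zl (d + 1) (m - δ) * Real.exp (-δ * l1 (u - (N : ℤ) • y')))) δ := by
  have hC := hX.nonneg
  have hterm : ∀ κ' : Fin (d + 1), BiLoc (wsum (r ν y' κ') (X κ u κ')) u u
      (Cr * C * Zl (d + 1) (m - δ) * Real.exp (-δ * l1 (u - (N : ℤ) • y'))) δ :=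
    fun κ' => biLoc_wsum_far_keep (fun u' => hr ν y' κ' u') (fun u' => hX κ u κ' u') hδ hm hr.nonneg hC
  have hsum := biLoc_finset_sum (Finset.univ : Finset (Fin (d + 1))) (fun κ' _ => hterm κ')
  simp only [Finset.sum_const, Finset.card_univ, Fintype.card_fin, nsmul_eq_mul] at hsum
  exact hsum

/-- [folklore] Packaged: the family of inner slices `κ u ↦ vertexW r (X κ u) ν y′` IS a local stencil family at rate `δ` (far factor dropped). -/
theorem locStencil_slice_keep (hr : LegDecay r N Cr m)
    {X : Fin (d + 1) → (Fin (d + 1) → ℤ) → Fin (d + 1) → (Fin (d + 1) → ℤ) → MKer (d + 1) (Fib d)} (hX : LocStencil₂ X C δ)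
    (hδ : 0 ≤ δ) (hm : δ < m) (ν : Fin (d + 1)) (y' : Fin (d + 1) → ℤ) :
    LocStencil (fun κ u => vertexW r (X κ u) ν y') ((d + 1 : ℕ) * (Cr * C * Zl (d + 1) (m - δ))) δ := by
  intro κ u
  have h := biLoc_vertexW_slice_keep hr hX hδ hm κ u ν y'
  intro x z a b
  refine (h x z a b).trans (mul_le_mul_of_nonneg_right ?_ (Real.exp_pos _).le)
  have hexp : Real.exp (-δ * l1 (u - (N : ℤ) • y')) ≤ 1 := by
    rw [Real.exp_le_one_iff]; nlinarith [l1_nonneg (u - (N : ℤ) • y')]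
  have h0 : 0 ≤ (d + 1 : ℕ) * (Cr * C * Zl (d + 1) (m - δ)) := by
    have := hr.nonneg; have := hX.nonneg; have := Zl_nonneg (D := d + 1) (show 0 < m - δ by linarith); positivity
  calc ((d + 1 : ℕ) : ℝ) * (Cr * C * Zl (d + 1) (m - δ) * Real.exp (-δ * l1 (u - (N : ℤ) • y')))
      = (d + 1 : ℕ) * (Cr * C * Zl (d + 1) (m - δ)) * Real.exp (-δ * l1 (u - (N : ℤ) • y')) := by ring
    _ ≤ (d + 1 : ℕ) * (Cr * C * Zl (d + 1) (m - δ)) * 1 := mul_le_mul_of_nonneg_left hexp h0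
    _ = _ := by ring

/-- [folklore] **THE SECOND-ORDER VERTEX AT KEPT RATE**: `LocStencil₂ X C δ` read through a leg family at rate `m > 3δ` in both table legs is
bi-localised at the first dilated coarse point AT RATE `δ`, with the far factor `e^{−δ·|N•y − N•y′|₁}` and the constant
`(d+1)²·C_r²·C·Zl(m−δ)·Zl(m−3δ)` (an2's `vertexFamily₂_vertex2OfK` shape without the loss `m ↦ m/8`). -/
theorem biLoc_vertex2W_keep (hr : LegDecay r N Cr m)
    {X : Fin (d + 1) → (Fin (d + 1) → ℤ) → Fin (d + 1) → (Fin (d + 1) → ℤ) → MKer (d + 1) (Fib d)} (hX : LocStencil₂ X C δ)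
    (hδ : 0 ≤ δ) (hm : 3 * δ < m) (μ : Fin (d + 1)) (y : Fin (d + 1) → ℤ) (ν : Fin (d + 1)) (y' : Fin (d + 1) → ℤ) :
    BiLoc (vertex2W r X μ y ν y') ((N : ℤ) • y) ((N : ℤ) • y)
      ((d + 1 : ℕ) * (Cr * ((d + 1 : ℕ) * (Cr * C * Zl (d + 1) (m - δ))) * Zl (d + 1) (m - 3 * δ)
        * Real.exp (-δ * l1 ((N : ℤ) • y - (N : ℤ) • y')))) δ := by
  have hC := hX.nonneg
  have hCr := hr.nonneg
  have hin : ∀ (κ : Fin (d + 1)) (u : Fin (d + 1) → ℤ), BiLoc (vertexW r (X κ u) ν y') u u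
      ((d + 1 : ℕ) * (Cr * C * Zl (d + 1) (m - δ)) * Real.exp (-δ * l1 (u - (N : ℤ) • y'))) δ := by
    intro κ u
    have h := biLoc_vertexW_slice_keep hr hX hδ (by linarith) κ u ν y'
    rw [← mul_assoc] at h
    exact h
  have hK₁ : 0 ≤ (d + 1 : ℕ) * (Cr * C * Zl (d + 1) (m - δ)) := by
    have := Zl_nonneg (D := d + 1) (show 0 < m - δ by linarith); positivity
  have hterm : ∀ κ : Fin (d + 1), BiLoc (wsum (r μ y κ) (fun u => vertexW r (X κ u) ν y')) ((N : ℤ) • y) ((N : ℤ) • y)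
      (Cr * ((d + 1 : ℕ) * (Cr * C * Zl (d + 1) (m - δ))) * Zl (d + 1) (m - 3 * δ)
        * Real.exp (-δ * l1 ((N : ℤ) • y - (N : ℤ) • y'))) δ :=
    fun κ => biLoc_wsum_twoCentre_keep (fun u => hr μ y κ u) (hin κ) hδ hm hCr hK₁
  have hsum := biLoc_finset_sum (Finset.univ : Finset (Fin (d + 1))) (fun κ _ => hterm κ)
  simp only [Finset.sum_const, Finset.card_univ, Fintype.card_fin, nsmul_eq_mul] at hsum
  exact hsum

end Summit.QuantumFields.BalabanUV.Beta.GAN24.Push4Bounds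

end
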